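import Summits.QuantumFields.YangMills.Theses.CoincidenceRotationBootstrap
import Summits.QuantumFields.YangMills.Theorems.IsotropyFromPowerCountingAssembly
import Summits.QuantumFields.YangMills.Theorems.PencilRigidityCurvatureChannel
import Summits.QuantumFields.YangMills.Theorems.LangevinControlUVOSLegsFromFemtoAndGapStubUpgradeGivens
import Summits.QuantumFields.YangMills.Theorems.PencilRigidityDiagonalMirrorRPRRestated
import Literature.MathematicalPhysics.QuantumFieldTheory.TiltedTorusLatticeSchwinger
import HarnessLib.Audit

/-!
# Line `tilted-cover-transfer` for crux `CurvatureAmnesia` (item stmt-QuantumFields-16192) — strategist s1, 2026-08-17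

Crux decl `Summit.QuantumFields.YangMills.Theses.CoincidenceRotationBootstrap.CurvatureAmnesia` (shared
verbatim with `ScalingWindowSplit.CurvatureAmnesia`): Σ5 ORIENTATION AMNESIA of the curvature species of
every weak-coupling Wilson limit carrying the OS guards, the lattice tie, non-triviality and the two gaps.

**Lens: TRANSFER at crux level, second generation.**  The registered transfer line
`Lines/mirror_boost_transfer.lean` (strategist b1) closes the crux from the sibling routes' SIXTEEN-MIRROR BOOST
ENGINE — reflection positivity in the eight planar frames ⇒ the planar spectral cone (`PlanarSpectralCone_of`,
LANDED) ⇒ complex planar rotations are boosts ⇒ with UV power counting (soft kernel K, tempered moments T, heat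
sandwich Σ; `T → Σ → B′` LANDED, `engineFromPowerCounting_proof`) the π/2-periodic orbit functions are band-limited
and the parity sieve leaves only the zero mode ⇒ planar invariance ⇒ (`PlanarToEuclidean_holds`, exact group
theory) SO(4) ⊇ Σ5.  Its four stubs were the items K (11687), D (10604), T (17721), Σ (18372).  Since then the
item D = `MirrorModularBoosts.DiagonalMirrorRPR` has been returned `verdict: misstated` by TWENTY-SIX concurring
line leads (Cruxes/DiagonalMirrorRPR/NOTES.md, PICKED.md c23, 2026-08-17T12:27Z): (i) D is typed for every
coupling sign, and for `β < 0` the cut-plaquette kernel `exp((β/N) Re tr ρ(gh⁻¹))` has a negative 2×2 minor, so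
no diagonal Schur cut exists (N⁻); (ii) the scheme's tori `ℤ⁴/(2L_k+1)ℤ⁴` are ODD and carry no diagonal mirror
PAIR — the swap-RP volume for Wilson's action is the Fröhlich–Israel–Lieb–Simon 45° cover `T̃_{2L_k+1}` (Literature:
`TiltedTorus.expect_conj_swap_mul_nonneg`, FILS 1978 Thm 2.1) — and no clause of the curvature package `W₁` relates
the torus correlators to the cover correlators at physical scale (T⁺).  The leads' recommended honest typing is the
RESTATED crux `W₁ → sch.HasWeakCouplingLimit → tilted-cover convergence → DiagonalFrameRP`, which is a LANDED THEOREM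
(`ParityBridgeColdTraces.Reduction.stub_restatedCrux_closes`, p97653; weak-coupling form
`CentreTwistedSwap.Reduction.restatedCruxWeakCoupling_holds`, p117149), leaving as the one open leaf the
cross-volume transport `TiltedCoverConvergence` (their `T_wc`, `Lines/promote-terms-c6.md` of crux 10604).

THIS line is the boost engine with D REPLACED by exactly that leaf, in its weak-coupling form — which THIS crux can
feed, because `CurvatureAmnesia` carries `sch.HasWeakCouplingLimit` as its first hypothesis (D's home routes do not
hand it to D).  Registered stubs (the ONLY `sorry`s):

* `stub_curvatureKernelBound`      = `MirrorModularBoosts.CurvatureKernelBound`           (K, item stmt-QuantumFields-11687)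
* `stub_temperedCurvatureMoments`  = `IsotropyFromPowerCounting.TemperedCurvatureMoments` (T, item stmt-QuantumFields-17721)
* `stub_curvatureSandwichBound`    = `IsotropyFromPowerCounting.CurvatureSandwichBound`   (Σ, item stmt-QuantumFields-18372)
* `stub_tiltedCoverConvergence`    — NEW (T_wc): for every compact simple `G`, `r`, `sch`, one-species family `S₁`
  with the curvature package `CurvaturePackage r sch S₁` (= `W₁`, the LANDED readback of crux 10604) and
  `sch.HasWeakCouplingLimit`, the renormalised curvature strings computed on the 45° covers `T̃_{2L_k+1}`
  (`tiltedLatticeSchwinger`, Literature) converge on `⁰𝒮` to the SAME `S₁`: finite-size / boundary-condition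
  insensitivity of the weak-coupling Wilson limit at physical scale (torus ℤ⁴/(2L_k+1)ℤ⁴ versus its FILS double
  cover), the input "any transport of diagonal reflection positivity to a continuum limit needs"
  (TiltedTorusLatticeSchwinger.lean, module docstring).  Character-identical to the 10604 leads' `T_wc.term`
  up to naming `W₁` by its landed readback `CurvaturePackage`, so that an item filed from either side dedups.

`CurvatureAmnesia_of : K → T → Σ → T_wc → CurvatureAmnesia` (sorry-free, §4):
1. the curvature channel `S₁ n := S n (fun _ ↦ r.curvature)` of a family `S` with the crux's hypotheses carries
   `W1 r sch S₁` and is reflection positive in the four AXIS frames (`w1_of_package`, as in the b1 line; the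
   crux's non-triviality hypothesis is not used);
2. the crux's OWN weak-coupling hypothesis `hW` + T_wc at `S₁` + the landed restated-D closer give
   `DiagonalFrameRP S₁` (the four DIAGONAL frames), hence `EightFrameRP S₁`; the cone by `PlanarSpectralCone_of`;
3. B′ (from T and Σ by the landed engine) fed K's kernel triple gives `PlanarInvariant S₁`;
4. `PlanarToEuclidean_holds` and `det R = 1` for the Σ5 rotation (`det_eq_one_of_isSigmaFive`) give the Σ5 clause.

Why this dodges the STUCK goal of the live line `Lines/WardDefectSketch.lean`: there the single open stub
`stub_wardNullity_two_le` (W₂) is CERTIFIED equivalent to the crux (`curvatureAmnesia_iff_wardNullity_two_le`,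
p157344) — the rotation-Ward identity of the Wilson limit, whose only engine is the uncharted non-perturbative
`(a/ℓ)²`-irrelevance of the dimension-6 operators.  Here NO stub is a symmetry statement and none is equivalent to
the crux or to the summit: K / T / Σ are UV REGULARITY of the tied `tr F²` channel (refutable only by `tr F²`
acquiring UV dimension ≥ 5 in an asymptotically free theory; staffed items with live skeletons), T_wc is an
INFRARED finite-size transport between two boundaryless volumes of the same lattice theory at the same couplings
(engine: the volume-uniform lattice gap of `W₁`; it is false for NO known inhabitant — every certifiable
`W₁`-inhabitant is ultralocal at physical scale, where torus and cover strings both tend to constants), and the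
Σ5 symmetry is manufactured by landed theorems.  Why it supersedes `mirror_boost_transfer`: that line can never
close while its stub D stands at a signature its own leads grade misstated; this one consumes D's landed repair.

Negative knowledge honoured (`Cruxes/CurvatureAmnesia/Disproof.lean` v3, cdisprove cycle 1): F1 (`¬crux` needs a
weak-coupling uniformly gapped Wilson scheme) — every stub here is likewise protected; F2/F3 (the TIE is
load-bearing; the model-blind form is false modulo `IsotropicOSFamilyExists`, witness `S_iso + J'`) — the line uses
the tie three times: K/T/Σ are TIED UV data (the W(B₄)-symmetric generalised free fields of the zoo violate K), T_wc
is a statement about the lattice approximants themselves, and `w1_of_package` forwards the tie into `W1`; F5 (the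
two-point shadow `e^{−‖z‖₁}` passes every axis mirror and fails Σ5) — it also fails the planar spectral cone
(its spectral measure is `δ₁(ω) ⊗ Cauchy(p₁)`, not supported in `ω ≥ |p₁|`), which is exactly why the DIAGONAL frames
(step 2) are load-bearing and cannot be dropped.  `ledger negatives --problem QuantumFields`: the unrepaired
`MirrorModularBoosts.DiagonalMirrorRP` (S₁ 0 unconstrained) is avoided as in b1 (the package carries E0); no stub
is an instance of a landed `Negative/` lemma of this crux (`CurvatureAmnesiaModelBlind`, `TwoPointShadow` have no
lattice side).
-/

noncomputable section

namespace Summit.QuantumFields.YangMills.Cruxes.CurvatureAmnesia.TiltedCoverTransfer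

open scoped BigOperators Topology SchwartzMap
open Filter
open Literature.MathematicalPhysics.QuantumLattice Literature.MathematicalPhysics.AQFT
  Literature.MathematicalPhysics.QuantumFieldTheory
open Summit.QuantumFields.YangMills.Theses.CoincidenceRotationBootstrap (CurvatureAmnesia)
open Summit.QuantumFields.YangMills.Theorems.CurvatureBoostCovariance.Negative
  (W1 EightFrameRP PlanarCone PlanarInvariant)
open Summit.QuantumFields.YangMills.Cruxes.DiagonalMirrorRPR.ParityBridgeColdTraces
  (CurvaturePackage DiagonalFrameRP)

/-- `ℝ⁴` (file-local notation). -/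
local notation "E4" => EuclideanSpace ℝ (Fin 4)

/-! ## §1 The registered stubs (the ONLY `sorry`s of this file) -/

/-- (K) the soft two-point kernel of the curvature channel — item stmt-QuantumFields-11687 BY NAME. -/
theorem stub_curvatureKernelBound :
    Summit.QuantumFields.YangMills.Theses.MirrorModularBoosts.CurvatureKernelBound := by
  sorry

/-- (T) tempered renormalised lattice moment densities tied to the curvature channel —
item stmt-QuantumFields-17721 BY NAME. -/
theorem stub_temperedCurvatureMoments :
    Summit.QuantumFields.YangMills.Theses.IsotropyFromPowerCounting.TemperedCurvatureMoments := by
  sorry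

/-- (Σ) the transversely filtered heat-sandwich bound with one power of slack, `μ < 4` —
item stmt-QuantumFields-18372 BY NAME. -/
theorem stub_curvatureSandwichBound :
    Summit.QuantumFields.YangMills.Theses.IsotropyFromPowerCounting.CurvatureSandwichBound := by
  sorry

/-- **(T_wc) Tilted-cover convergence at weak coupling** — THE NEW STUB (the honest open leaf of the sibling crux
`DiagonalMirrorRPR`, `Lines/promote-terms-c6.md` of stmt-QuantumFields-10604, weak-coupling form).  For every compact
simple `G` (Borel σ-algebra), lattice representation `r`, scheme `sch` and one-species Schwinger family `S₁` carrying
the curvature package `W₁` (`CurvaturePackage`: the tie of the renormalised curvature strings to `S₁` on `⁰𝒮` along the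
scheme's tori `ℤ⁴/(2L_k+1)ℤ⁴`, the OS block E0/E0h/E0'/E2/E3/E4 of `S₁`, translations, proper signed permutations,
the continuum gap of `S₁` and the volume-uniform lattice gap `HasLatticeMassGap r sch Δ`) and taken AT WEAK COUPLING
(`β_k → +∞`), the renormalised curvature strings computed on the Fröhlich–Israel–Lieb–Simon 45° covers `T̃_{2L_k+1}`
(same box, spacing, coupling, renormalisations: `tiltedLatticeSchwinger`) converge on every off-diagonal real tensor
to the SAME `S₁`.  Finite-size transport between two boundaryless volumes of one lattice theory; the cover is swap
reflection positive for `β ≥ 0` (`TiltedTorus.expect_conj_swap_mul_nonneg`), the torus is not. -/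
theorem stub_tiltedCoverConvergence :
    ∀ (G : Type) [Group G] [TopologicalSpace G] [IsTopologicalGroup G] [CompactSpace G],
      IsCompactSimpleLieGroup G →
        letI : MeasurableSpace G := borel G
        haveI : BorelSpace G := ⟨rfl⟩
        ∀ (r : LatticeRep G) (sch : SpeciesScheme (YMSpecies G))
          (S₁ : SchwingerFamily (EuclideanSpace ℝ (Fin 4))),
          CurvaturePackage r sch S₁ → sch.HasWeakCouplingLimit →
            ∀ (n : ℕ), n ≠ 0 → ∀ (f : Fin n → 𝓢(EuclideanSpace ℝ (Fin 4), ℝ))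
              (F : 𝓢((Fin n → EuclideanSpace ℝ (Fin 4)), ℂ)),
              IsTensorOf F (fun i => ofRealTest (f i)) → IsOffDiagonal F →
                Tendsto (fun k : ℕ =>
                  ((tiltedLatticeSchwinger r.ρ sch (fun s => s.F) k n (fun _ => r.curvature) f : ℝ) : ℂ))
                  atTop (𝓝 (S₁ n F)) := by
  sorry

/-! ### Name-keyed aliases of the four statements (hypotheses of the composition) -/
namespace Registered

/-- Alias of K keyed by the registered stub name. -/
abbrev stub_curvatureKernelBound : Prop :=
  Summit.QuantumFields.YangMills.Theses.MirrorModularBoosts.CurvatureKernelBound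
/-- Alias of T keyed by the registered stub name. -/
abbrev stub_temperedCurvatureMoments : Prop :=
  Summit.QuantumFields.YangMills.Theses.IsotropyFromPowerCounting.TemperedCurvatureMoments
/-- Alias of Σ keyed by the registered stub name. -/
abbrev stub_curvatureSandwichBound : Prop :=
  Summit.QuantumFields.YangMills.Theses.IsotropyFromPowerCounting.CurvatureSandwichBound
/-- Alias of T_wc keyed by the registered stub name: the expanded statement verbatim. -/
abbrev stub_tiltedCoverConvergence : Prop :=
  ∀ (G : Type) [Group G] [TopologicalSpace G] [IsTopologicalGroup G] [CompactSpace G],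
    IsCompactSimpleLieGroup G →
      letI : MeasurableSpace G := borel G
      haveI : BorelSpace G := ⟨rfl⟩
      ∀ (r : LatticeRep G) (sch : SpeciesScheme (YMSpecies G))
        (S₁ : SchwingerFamily (EuclideanSpace ℝ (Fin 4))),
        CurvaturePackage r sch S₁ → sch.HasWeakCouplingLimit →
          ∀ (n : ℕ), n ≠ 0 → ∀ (f : Fin n → 𝓢(EuclideanSpace ℝ (Fin 4), ℝ))
            (F : 𝓢((Fin n → EuclideanSpace ℝ (Fin 4)), ℂ)),
            IsTensorOf F (fun i => ofRealTest (f i)) → IsOffDiagonal F →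
              Tendsto (fun k : ℕ =>
                ((tiltedLatticeSchwinger r.ρ sch (fun s => s.F) k n (fun _ => r.curvature) f : ℝ) : ℂ))
                atTop (𝓝 (S₁ n F))

end Registered

/-! ## §2 Geometry: the Σ5 rotation is proper (no `sorry` below this line) -/

section Geometry

open Summit.QuantumFields.YangMills.Theorems.OSLegsFromFemtoAndGap.Upgrade
open Summit.QuantumFields.YangMills.Theorems.PlanarToEuclidean

/-- The Σ5 clause of the crux (verbatim): `R e₀ = e₀`, `R e₁ = e₁`, `R e₂ = (3e₂+4e₃)/5`,
`R e₃ = (−4e₂+3e₃)/5`. -/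
def IsSigmaFive (R : E4 ≃ₗᵢ[ℝ] E4) : Prop :=
  R (EuclideanSpace.single 0 1) = EuclideanSpace.single 0 1 ∧
    R (EuclideanSpace.single 1 1) = EuclideanSpace.single 1 1 ∧
      R (EuclideanSpace.single 2 1) =
          (3/5 : ℝ) • EuclideanSpace.single 2 1 + (4/5 : ℝ) • EuclideanSpace.single 3 1 ∧
        R (EuclideanSpace.single 3 1) =
          -((4/5 : ℝ) • EuclideanSpace.single 2 1) + (3/5 : ℝ) • EuclideanSpace.single 3 1

/-- A Σ5 isometry is the conjugate `Q ∘ ρ_θ ∘ Q⁻¹` of the `(x₀,x₁)`-rotation by `θ` (`cos θ = 3/5`,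
`sin θ = -4/5`) by any isometry `Q : e₀ ↦ e₂, e₁ ↦ e₃, e₂ ↦ e₀, e₃ ↦ e₁`; hence it has the determinant of
that conjugate. [folklore] -/
theorem det_eq_det_conj_of_isSigmaFive (R : E4 ≃ₗᵢ[ℝ] E4) (hR : IsSigmaFive R) {θ : ℝ}
    (hc : Real.cos θ = 3 / 5) (hs : Real.sin θ = -(4 / 5)) (Q : E4 ≃ₗᵢ[ℝ] E4)
    (hQ0 : Q (EuclideanSpace.single 0 1) = EuclideanSpace.single 2 1)
    (hQ1 : Q (EuclideanSpace.single 1 1) = EuclideanSpace.single 3 1)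
    (hQ2 : Q (EuclideanSpace.single 2 1) = EuclideanSpace.single 0 1)
    (hQ3 : Q (EuclideanSpace.single 3 1) = EuclideanSpace.single 1 1) :
    LinearMap.det (R.toLinearEquiv : E4 →ₗ[ℝ] E4) =
      LinearMap.det ((Q.trans ((planeRot (d := 3) 0 θ).trans Q.symm)).toLinearEquiv : E4 →ₗ[ℝ] E4) := by
  have hQs0 : Q.symm (EuclideanSpace.single 0 1) = EuclideanSpace.single 2 1 := by
    rw [← hQ2, LinearIsometryEquiv.symm_apply_apply]
  have hQs1 : Q.symm (EuclideanSpace.single 1 1) = EuclideanSpace.single 3 1 := by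
    rw [← hQ3, LinearIsometryEquiv.symm_apply_apply]
  have hQs2 : Q.symm (EuclideanSpace.single 2 1) = EuclideanSpace.single 0 1 := by
    rw [← hQ0, LinearIsometryEquiv.symm_apply_apply]
  have hQs3 : Q.symm (EuclideanSpace.single 3 1) = EuclideanSpace.single 1 1 := by
    rw [← hQ1, LinearIsometryEquiv.symm_apply_apply]
  set R' : E4 ≃ₗᵢ[ℝ] E4 := Q.trans ((planeRot (d := 3) 0 θ).trans Q.symm) with hR'
  have h0' : R' (EuclideanSpace.single 0 1) = EuclideanSpace.single 0 1 := by
    rw [hR', LinearIsometryEquiv.trans_apply, LinearIsometryEquiv.trans_apply, hQ0, rho_e2, hQs2]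
  have h1' : R' (EuclideanSpace.single 1 1) = EuclideanSpace.single 1 1 := by
    rw [hR', LinearIsometryEquiv.trans_apply, LinearIsometryEquiv.trans_apply, hQ1, rho_e3, hQs3]
  have h2' : R' (EuclideanSpace.single 2 1) =
      (3 / 5 : ℝ) • EuclideanSpace.single 2 1 + (4 / 5 : ℝ) • EuclideanSpace.single 3 1 := by
    rw [hR', LinearIsometryEquiv.trans_apply, LinearIsometryEquiv.trans_apply, hQ2, rho_e0, map_add,
      map_smul, map_smul, hQs0, hQs1, hc, hs, neg_neg]
  have h3' : R' (EuclideanSpace.single 3 1) =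
      -((4 / 5 : ℝ) • EuclideanSpace.single 2 1) + (3 / 5 : ℝ) • EuclideanSpace.single 3 1 := by
    rw [hR', LinearIsometryEquiv.trans_apply, LinearIsometryEquiv.trans_apply, hQ3, rho_e1, map_add,
      map_smul, map_smul, hQs0, hQs1, hc, hs, neg_smul]
  obtain ⟨hR0, hR1, hR2, hR3⟩ := hR
  have hlin : (R.toLinearEquiv : E4 →ₗ[ℝ] E4) = (R'.toLinearEquiv : E4 →ₗ[ℝ] E4) := by
    refine (EuclideanSpace.basisFun (Fin 4) ℝ).toBasis.ext fun i => ?_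
    simp only [OrthonormalBasis.coe_toBasis, EuclideanSpace.basisFun_apply, LinearEquiv.coe_coe,
      LinearIsometryEquiv.coe_toLinearEquiv]
    fin_cases i
    · exact hR0.trans h0'.symm
    · exact hR1.trans h1'.symm
    · exact hR2.trans h2'.symm
    · exact hR3.trans h3'.symm
  rw [hlin]

/-- **The Σ5 rotation is proper**: `det R = det Q_B · det ρ_θ · det Q_B⁻¹ = 1`. [folklore] -/
theorem det_eq_one_of_isSigmaFive (R : E4 ≃ₗᵢ[ℝ] E4) (hR : IsSigmaFive R) :
    LinearMap.det (R.toLinearEquiv : E4 →ₗ[ℝ] E4) = 1 := by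
  obtain ⟨θ, hc, hs⟩ := exists_cos_eq_and_sin_eq_neg (a := 3 / 5) (b := 4 / 5) (by norm_num)
  obtain ⟨hQdet, hQ0, hQ1, hQ2, hQ3⟩ := QB_spec
  rw [det_eq_det_conj_of_isSigmaFive R hR hc hs _ hQ0 hQ1 hQ2 hQ3, det_trans, hQdet, one_mul, det_trans,
    det_rho, det_symm hQdet, one_mul]

end Geometry

/-! ## §3 The curvature channel of the amnesia package carries `W1` and the axis frames -/

section Channel

open Summit.QuantumFields.YangMills.Theorems.CurvatureChannel

variable {G : Type} [Group G] [TopologicalSpace G] [IsTopologicalGroup G] [CompactSpace G]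
  [MeasurableSpace G] [BorelSpace G]

/-- The guard package of the crux (its second hypothesis, verbatim): E0 (normalisation, hermiticity), E0',
E2, E3, E4, translation invariance and proper-hypercubic invariance on `⁰𝒮`. -/
def Guards {ι : Type} (S : LabelledSchwingerFamily ι E4) : Prop :=
  S.IsNormalized ∧ S.IsHermitian ∧ S.HasLinearGrowth ∧ S.IsReflectionPositive ∧ S.IsSymmetric ∧
    S.HasClusterProperty ∧
    (∀ (n : ℕ) (k : Fin n → ι) (a : E4) (F : 𝓢((Fin n → E4), ℂ)), IsOffDiagonal F →
      S n k (translateMulti a F) = S n k F) ∧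
    (∀ (n : ℕ) (k : Fin n → ι) (R : E4 ≃ₗᵢ[ℝ] E4), LinearMap.det (R.toLinearEquiv : E4 →ₗ[ℝ] E4) = 1 →
      (∀ i : Fin 4, ∃ j : Fin 4, R (EuclideanSpace.single i 1) = EuclideanSpace.single j 1 ∨
        R (EuclideanSpace.single i 1) = -EuclideanSpace.single j 1) →
      ∀ F : 𝓢((Fin n → E4), ℂ), IsOffDiagonal F → S n k (linActMulti R F) = S n k F)

/-- The lattice TIE of the crux (its third hypothesis, verbatim = the body of `IsYangMillsFor`). -/
def IsLatticeLimit (r : LatticeRep G) (sch : SpeciesScheme (YMSpecies G))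
    (S : LabelledSchwingerFamily (YMSpecies G) E4) : Prop :=
  ∀ (n : ℕ), n ≠ 0 → ∀ (σ : Fin n → YMSpecies G) (f : Fin n → 𝓢(E4, ℝ)) (F : 𝓢((Fin n → E4), ℂ)),
    IsTensorOf F (fun i => ofRealTest (f i)) → IsOffDiagonal F →
      Tendsto (fun k : ℕ => ((latticeSchwinger r.ρ sch (fun s => s.F) k n σ f : ℝ) : ℂ)) atTop
        (𝓝 (S n σ F))

/-- Continuum and volume-uniform lattice mass gaps (the crux's fifth hypothesis, verbatim). -/
def HasGaps (r : LatticeRep G) (sch : SpeciesScheme (YMSpecies G))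
    (S : LabelledSchwingerFamily (YMSpecies G) E4) : Prop :=
  ∃ Δ : ℝ, 0 < Δ ∧ S.HasMassGap Δ ∧ HasLatticeMassGap r sch Δ

/-- **Restriction + axis transport for the amnesia package.**  If a labelled family `S` over the
Yang–Mills species carries the crux's guards, its lattice tie and its gaps, then the curvature channel
`S₁ n := S n (fun _ ↦ r.curvature)` carries the one-species package `W1 r sch S₁` of the sibling cruxes and is
reflection positive in pull-back form in the four axis frames `R e₀ ∈ {±e₀, ±e₁}`.  (Label specialisation
exactly as in `Theorems.curvatureChannel_proof`; verbatim the b1 line's lemma.) [folklore] -/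
theorem w1_of_package (r : LatticeRep G) (sch : SpeciesScheme (YMSpecies G))
    (S : LabelledSchwingerFamily (YMSpecies G) E4) (hax : Guards S) (hconv : IsLatticeLimit r sch S)
    (hgaps : HasGaps r sch S) :
    W1 r sch (fun n => S n (fun _ => r.curvature)) ∧
      (∀ (R : E4 ≃ₗᵢ[ℝ] E4) (a b : ℝ), a ^ 2 + b ^ 2 = 1 → (a = 0 ∨ b = 0) →
        R (EuclideanSpace.single 0 1) = a • EuclideanSpace.single 0 1 + b • EuclideanSpace.single 1 1 →
          (SchwingerFamily.toLabelled
            (fun n => (S n (fun _ => r.curvature)).comp (linActMulti R))).IsReflectionPositive) := by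
  obtain ⟨hnorm, hherm, hgrowth, hrp, hsymm, hclus, htr, hhyp⟩ := hax
  obtain ⟨Δ, hΔ, hgap, hlat⟩ := hgaps
  -- E2 of the curvature channel (label specialisation)
  have hrp₁ : (SchwingerFamily.toLabelled (fun n => S n fun _ => r.curvature)).IsReflectionPositive := by
    intro N deg lab F hF H hH
    have h := hrp N deg (fun j _ => r.curvature) F hF H hH
    simp only [append_const_rev] at h
    simpa only [SchwingerFamily.toLabelled_apply] using h
  -- proper hypercubic invariance of the curvature channel on `⁰𝒮`
  have hhyp₁ : ∀ R : E4 ≃ₗᵢ[ℝ] E4, LinearMap.det (R.toLinearEquiv : E4 →ₗ[ℝ] E4) = 1 →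
      (∀ i : Fin 4, ∃ j : Fin 4, R (EuclideanSpace.single i 1) = EuclideanSpace.single j 1 ∨
        R (EuclideanSpace.single i 1) = -EuclideanSpace.single j 1) →
      ∀ (n : ℕ) (F : 𝓢((Fin n → E4), ℂ)), IsOffDiagonal F →
        S n (fun _ => r.curvature) (linActMulti R F) = S n (fun _ => r.curvature) F :=
    fun R hdet hsp n F hF => hhyp n (fun _ => r.curvature) R hdet hsp F hF
  refine ⟨⟨?_, ⟨?_, ?_, ?_, hrp₁, ?_, ?_⟩, ?_, hhyp₁, Δ, hΔ, ?_, hlat⟩, ?_⟩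
  · -- lattice convergence of the curvature strings
    exact fun n hn f F hF hF' => hconv n hn (fun _ => r.curvature) f F hF hF'
  · -- E0 (normalisation)
    exact fun k F => hnorm (fun _ => r.curvature) F
  · -- E0 (hermiticity)
    exact fun n k F hF => hherm n (fun _ => r.curvature) F hF
  · -- E0' with the label alphabet `{r.curvature}`
    intro T
    obtain ⟨s, α, β, h⟩ := hgrowth {r.curvature}
    exact ⟨s, α, β, fun n k _ F hF =>
      h n (fun _ => r.curvature) (fun _ => Finset.mem_singleton_self _) F hF⟩
  · -- E3
    exact fun n k π F hF => hsymm n (fun _ => r.curvature) π F hF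
  · -- E4
    intro n m k k' F G' hF hG' a ha ha' H hH
    have h := hclus n m (fun _ => r.curvature) (fun _ => r.curvature) F G' hF hG' a ha ha' H hH
    rw [append_const_rev] at h
    exact h
  · -- translations
    exact fun n a F hF => htr n (fun _ => r.curvature) a F hF
  · -- the gap of the curvature sector
    exact hgap.restrict fun _ => r.curvature
  · -- reflection positivity in the four axis frames
    intro R a b hab h0 hR
    exact isReflectionPositive_comp_axisFrame (fun n => S n fun _ => r.curvature) hrp₁ hhyp₁ R a b
      hab h0 hR

/-- The sibling vocabulary agrees: the one-species package `W1` of `CurvatureBoostCovariance.Negative` IS the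
landed readback `CurvaturePackage` of crux 10604 (both are the crux's `W₁` verbatim; definitional). -/
theorem curvaturePackage_of_w1 (r : LatticeRep G) (sch : SpeciesScheme (YMSpecies G))
    (S₁ : SchwingerFamily E4) (h : W1 r sch S₁) : CurvaturePackage r sch S₁ :=
  h

/-- **The four diagonal frames from T_wc** (step 2 of the composition, isolated): under the curvature package,
weak coupling and tilted-cover convergence of the curvature strings, `S₁` is reflection positive in pull-back form
in every frame `R e₀ = a e₀ + b e₁`, `a² = b² = 1/2` — the LANDED restated crux of 10604
(`stub_restatedCrux_closes`, p97653) with its sign clause discharged by `β_k → +∞`. -/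
theorem diagonalFrameRP_of_tiltedCover (hG : IsCompactSimpleLieGroup G) (r : LatticeRep G)
    (sch : SpeciesScheme (YMSpecies G)) (S₁ : SchwingerFamily E4) (hW₁ : W1 r sch S₁)
    (hW : sch.HasWeakCouplingLimit)
    (htilt : ∀ (n : ℕ), n ≠ 0 → ∀ (f : Fin n → 𝓢(E4, ℝ)) (F : 𝓢((Fin n → E4), ℂ)),
      IsTensorOf F (fun i => ofRealTest (f i)) → IsOffDiagonal F →
        Tendsto (fun k : ℕ =>
          ((tiltedLatticeSchwinger r.ρ sch (fun s => s.F) k n (fun _ => r.curvature) f : ℝ) : ℂ))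
          atTop (𝓝 (S₁ n F))) :
    DiagonalFrameRP S₁ :=
  Summit.QuantumFields.YangMills.Cruxes.DiagonalMirrorRPR.ParityBridgeColdTraces.Reduction.stub_restatedCrux_closes
    G hG r sch S₁ (curvaturePackage_of_w1 r sch S₁ hW₁) (tendsto_atTop.1 hW 0) htilt

end Channel

/-! ## §4 Composition (kernel-checked; concludes the crux BY NAME) -/

/-- **The crux from the boost engine with the diagonal frames supplied by T_wc** (B′ as a hypothesis):
K, B′ = `SoftKernelBoostCovariance` and T_wc give `CurvatureAmnesia`.  The curvature channel of the amnesia package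
carries `W1` and the axis frames (`w1_of_package`); the crux's weak-coupling hypothesis, T_wc and the landed restated
crux of 10604 add the diagonal frames; the landed `PlanarSpectralCone_of` gives the cone; B′ fed K's kernel triple
gives invariance under the rotations of the `(x₀,x₁)`-plane; `PlanarToEuclidean_holds` and `det_eq_one_of_isSigmaFive`
give the Σ5 clause. -/
theorem CurvatureAmnesia_of_engine
    (hK : Summit.QuantumFields.YangMills.Theses.MirrorModularBoosts.CurvatureKernelBound)
    (hB : Summit.QuantumFields.YangMills.Theses.MirrorModularBoosts.SoftKernelBoostCovariance)
    (hTc : Registered.stub_tiltedCoverConvergence) :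
    CurvatureAmnesia := by
  intro G _ _ _ _ hG
  letI : MeasurableSpace G := borel G
  haveI : BorelSpace G := ⟨rfl⟩
  intro r sch S hW hax hconv _hNT hgap R hR n F₀ hF₀
  -- the curvature channel and its one-species package
  obtain ⟨hW₁, hAxis⟩ := w1_of_package r sch S hax hconv hgap
  have hhyp₁ := hW₁.2.2.2.1
  have hgrowth₁ := hW₁.2.1.2.2.1
  have hsymm₁ := hW₁.2.1.2.2.2.2.1
  have htr₁ := hW₁.2.2.1
  -- the four diagonal frames: weak coupling (the crux's own `hW`) + T_wc + the landed restated crux of 10604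
  have hDiag : DiagonalFrameRP (fun n => S n (fun _ => r.curvature)) :=
    diagonalFrameRP_of_tiltedCover hG r sch (fun n => S n (fun _ => r.curvature)) hW₁ hW
      (hTc G hG r sch (fun n => S n (fun _ => r.curvature)) (curvaturePackage_of_w1 r sch _ hW₁) hW)
  -- the eight planar frames: axis frames by transport, diagonal frames by `hDiag`
  have h8 : EightFrameRP (fun n => S n (fun _ => r.curvature)) := by
    intro R' a b hab hcase hR'
    rcases hcase with h0 | h0 | h0
    · exact hAxis R' a b hab (Or.inl h0) hR'
    · exact hAxis R' a b hab (Or.inr h0) hR'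
    · have ha : a ^ 2 = 1 / 2 := by linarith
      have hb : b ^ 2 = 1 / 2 := by linarith
      exact hDiag R' a b ha hb hR'
  -- the planar spectral cone (landed, model-blind)
  have hcone : PlanarCone (fun n => S n (fun _ => r.curvature)) :=
    Summit.QuantumFields.YangMills.Cruxes.PlanarSpectralCone.PositivityDiscToOperatorCone.PlanarSpectralCone_of
      (fun n => S n (fun _ => r.curvature)) hgrowth₁ hsymm₁ htr₁ h8
  -- the engine below dimension five, fed the kernel triple of K: planar rotations
  have hplanar : PlanarInvariant (fun n => S n (fun _ => r.curvature)) :=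
    hB G hG r sch (fun n => S n (fun _ => r.curvature)) hW₁ h8 hcone
      (hK G hG r sch (fun n => S n (fun _ => r.curvature)) hW₁)
  -- planar + proper hypercubic ⇒ every determinant-one isometry; the Σ5 rotation is one of them
  have hdet : LinearMap.det (R.toLinearEquiv : E4 →ₗ[ℝ] E4) = 1 := det_eq_one_of_isSigmaFive R hR
  exact Summit.QuantumFields.YangMills.Theses.MirrorModularBoosts.PlanarToEuclidean_holds Unit
    (SchwingerFamily.toLabelled (fun n => S n (fun _ => r.curvature)))
    (fun n k A hA hp F hF => hhyp₁ A hA hp n F hF)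
    (fun A hA h2 h3 n k F hF => hplanar A hA h2 h3 n F hF) n (fun _ => ()) R hdet F₀ hF₀

/-- **The crux from the four registered stubs** (concludes `CurvatureAmnesia` BY NAME): B′ is obtained from
T and Σ by the LANDED typed split `engineFromPowerCounting_proof` (item stmt-QuantumFields-17722, closed). -/
theorem CurvatureAmnesia_of (hK : Registered.stub_curvatureKernelBound)
    (hT : Registered.stub_temperedCurvatureMoments) (hS : Registered.stub_curvatureSandwichBound)
    (hTc : Registered.stub_tiltedCoverConvergence) : CurvatureAmnesia :=
  CurvatureAmnesia_of_engine hK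
    (Summit.QuantumFields.YangMills.Theorems.SoftKernelBoostCovariance.Sketch.engineFromPowerCounting_proof
      hT hS) hTc

/-- The crux along this skeleton, from the registered stubs (sorries only inside `stub_*`). -/
theorem CurvatureAmnesia_skeleton : CurvatureAmnesia :=
  CurvatureAmnesia_of stub_curvatureKernelBound stub_temperedCurvatureMoments stub_curvatureSandwichBound
    stub_tiltedCoverConvergence

/-! ### The shared crux under its other route name
`ScalingWindowSplit.CurvatureAmnesia` (item stmt-QuantumFields-16192 is wanted_by both routes; the two route copies are
verbatim, hence definitionally equal): `CurvatureAmnesia_of` closes it by the same term — see the companion evidence file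
`ScalingWindowSplitCurvatureAmnesiaSplitT.lean` (`scalingWindowSplit_curvatureAmnesia_of_subs : K → B′ → T_wc →
ScalingWindowSplit.CurvatureAmnesia`, sorry-free), not restated here so that this workfile does not import the
`ScalingWindowSplit` route file. -/

end Summit.QuantumFields.YangMills.Cruxes.CurvatureAmnesia.TiltedCoverTransfer

end
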